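import Mathlib.Combinatorics.SimpleGraph.Hasse
import Mathlib.Combinatorics.SimpleGraph.Connectivity.Connected
import Mathlib.Combinatorics.SimpleGraph.Walk.Basic
import Mathlib.Data.Int.SuccPred
import Mathlib.Algebra.Order.SuccPred
import Mathlib.Order.Interval.Set.OrdConnected
import Mathlib.Order.Interval.Set.Infinite
import Mathlib.Data.Int.Interval
import Literature.IUT.HodgeArakelov.ThetaSubgraphNorm
import HarnessLib

/-!
# [IUTchII] Remark 2.6.3 (i)–(iii): connected subgraphs `Γ' ⊆ Γ_Ÿ`, the quantity `‖Γ'‖`, infinite `Γ'` — proofs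

S. Mochizuki, *Inter-universal Teichmüller theory II*, §2, Remark 2.6.3 (kurims manuscript pp. 79–80)
together with Remark 2.1.1 (ii) (p. 65: the vertices of `Γ_X̲` labelled `{−l⋇, …, l⋇}`, `Γ^▶_Ÿ` the
`ι`-stable connected component with all `l` vertices) [cite: Mochizuki2012, Rmk 2.6.3 p.79]. PROOF-ONLY
companion (abc-iut cell, node ids `IUTchII:Rmk2.6.3(i)`, `(ii)`, `(iii)`) of the typer's `ThetaSubgraphNorm`
(`absLabel`, `fiber`, `fiberMinSq`, `labelCount = |Γ'|`, `subgraphNorm = ‖Γ'‖`, `interval a b = [-a, b]`); no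
new definitions. Sibling file `ThetaSubgraphNormFibers` treats (ii) (c) and (iv), (v). Claim key DISPUTED
(D-0012): everything here is elementary combinatorics of the PRINTED definitions and takes no side.

**Dictionary.** `Γ_Ÿ` = "a copy of the real line `ℝ`, in which the integers `ℤ ⊆ ℝ` are taken to be the
vertices, and the line segments joining the integers are taken to be the edges" (p. 79) = Mathlib's
`SimpleGraph.hasse ℤ` (`z ∼ w ↔ w = z + 1 ∨ z = w + 1`, `hasse_int_adj_iff`); a subgraph `Γ'` is its vertex
set, "connected" = connectedness of the induced subgraph; `Γ^▶_Ÿ = [−l⋇, l⋇] = interval (l/2) (l/2)`.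

**Proved.**
* (i) (a),(b): an induced subgraph of `Γ_Ÿ` is connected iff its vertex set is order-convex and nonempty
  (`connected_iff_ordConnected_and_nonempty`); hence a finite `Γ'` is connected and contains `0` iff
  `Γ' = [−a, b]` (`preconnected_and_zero_mem_iff`) — the standing assumption of the typer's interval
  computations, now a theorem.
* (ii) (d) complements: `|Γ'| ≤ l⋇` for EVERY finite `Γ'` (`labelCount_le_half`) — so print's "constant for
  `|Γ'| ≥ l⋇`" is the single case `=`; "valued in the positive rational numbers"
  (`subgraphNorm_interval_pos`); "attains its maximum when `|Γ'| = l⋇` — hence, in particular, when `Γ'` is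
  taken to be `Γ^▶_Ÿ`" as `‖[-a,b]‖ ≤ ‖Γ^▶_Ÿ‖` (`subgraphNorm_interval_le_gammaArrow`); strict increase below
  `l⋇` (`normValue_strictMono`, the content of "[but not strictly increasing!]" being the saturation); the
  closed form for an arbitrary admissible `Γ'` (`subgraphNorm_eq_of_preconnected`).
* (iii): an infinite connected `Γ' ∋ 0` contains a half-line through `0`; every fiber-minimum exists and
  equals `j²` (`isLeast_fiber_sq_of_infinite`) and every nonzero label is attained (`labels_of_infinite`) —
  "`‖Γ'‖` is defined, finite … even for infinite `Γ'`" — and the resulting number is `‖Γ^▶_Ÿ‖`, the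
  maximum (`norm_of_infinite_eq_gammaArrow`): "the case of infinite `Γ'` may be excluded without loss of
  generality".
-/

namespace Literature.IUT.HodgeArakelov

namespace SubgraphNorm

open scoped BigOperators

/-! ### (i) (a),(b): connected subgraphs of `Γ_Ÿ = hasse ℤ` containing `0` are the intervals `[-a, b]` -/

/-- Adjacency in `Γ_Ÿ` ("the line segments joining the integers are taken to be the edges",
[IUTchII] Rmk 2.6.3 (i) p. 79): `z ∼ w` iff `w = z + 1` or `z = w + 1`. [cite: Mochizuki2012, Rmk 2.6.3 (i) p.79] -/
theorem hasse_int_adj_iff (z w : ℤ) : (SimpleGraph.hasse ℤ).Adj z w ↔ w = z + 1 ∨ z = w + 1 := by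
  rw [SimpleGraph.hasse_adj, Order.covBy_iff_add_one_eq, Order.covBy_iff_add_one_eq]
  constructor <;> rintro (h | h) <;> omega

/-- Adjacency in the subgraph of `Γ_Ÿ` induced on a vertex set `Γ'`. [cite: Mochizuki2012, Rmk 2.6.3 (i) p.79] -/
theorem induce_hasse_int_adj_iff {Γ : Set ℤ} (u v : Γ) :
    ((SimpleGraph.hasse ℤ).induce Γ).Adj u v ↔ (v : ℤ) = u + 1 ∨ (u : ℤ) = v + 1 :=
  SimpleGraph.induce_adj.trans (hasse_int_adj_iff _ _)

/-- **Rmk 2.6.3 (i) (a), necessity of convexity**: if the subgraph of `Γ_Ÿ` induced on `Γ'` is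
(pre)connected, then `Γ'` is order-convex — a walk from `z` to `w` inside `Γ'` must step through every
integer between them. [cite: Mochizuki2012, Rmk 2.6.3 (i) p.79] -/
theorem ordConnected_of_preconnected {Γ : Set ℤ}
    (h : ((SimpleGraph.hasse ℤ).induce Γ).Preconnected) : Γ.OrdConnected := by
  refine ⟨fun z hz w hw y hy => ?_⟩
  by_contra hyΓ
  obtain ⟨hzy, hyw⟩ := hy
  have hzy' : z < y := lt_of_le_of_ne hzy (by rintro rfl; exact hyΓ hz)
  have hyw' : y < w := lt_of_le_of_ne hyw (by rintro rfl; exact hyΓ hw)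
  obtain ⟨p⟩ := h ⟨z, hz⟩ ⟨w, hw⟩
  obtain ⟨d, -, hd1, hd2⟩ := p.exists_boundary_dart {v : Γ | (v : ℤ) < y} hzy' (by
    simp only [Set.mem_setOf_eq, not_lt]; exact hyw'.le)
  have hadj := (induce_hasse_int_adj_iff _ _).mp d.adj
  simp only [Set.mem_setOf_eq, not_lt] at hd1 hd2
  have hmem : (d.toProd.2 : ℤ) ∈ Γ := d.toProd.2.2
  rcases hadj with h1 | h1
  · have : (d.toProd.2 : ℤ) = y := by omega
    exact hyΓ (this ▸ hmem)
  · omega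

/-- **Rmk 2.6.3 (i) (a), sufficiency**: an order-convex vertex set induces a preconnected subgraph of
`Γ_Ÿ` (walk along `z, z+1, …, w`). [cite: Mochizuki2012, Rmk 2.6.3 (i) p.79] -/
theorem preconnected_of_ordConnected {Γ : Set ℤ} (hΓ : Γ.OrdConnected) :
    ((SimpleGraph.hasse ℤ).induce Γ).Preconnected := by
  have key : ∀ n : ℕ, ∀ u v : Γ, (v : ℤ) = u + n →
      ((SimpleGraph.hasse ℤ).induce Γ).Reachable u v := by
    intro n
    induction n with
    | zero =>
      intro u v huv
      have : u = v := Subtype.ext (by simp at huv; omega)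
      subst this
      exact SimpleGraph.Reachable.refl _
    | succ k ih =>
      intro u v huv
      have hw : (u : ℤ) + k ∈ Γ := hΓ.out u.2 v.2 ⟨by omega, by push_cast at huv; omega⟩
      have h1 : ((SimpleGraph.hasse ℤ).induce Γ).Reachable u ⟨(u : ℤ) + k, hw⟩ := ih u ⟨_, hw⟩ rfl
      have h2 : ((SimpleGraph.hasse ℤ).induce Γ).Adj ⟨(u : ℤ) + k, hw⟩ v := by
        rw [induce_hasse_int_adj_iff]
        left; push_cast at huv; simp; omega
      exact h1.trans h2.reachable
  intro u v
  rcases le_total (u : ℤ) (v : ℤ) with huv | hvu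
  · exact key (v - u : ℤ).toNat u v (by rw [Int.toNat_of_nonneg (by omega)]; ring)
  · exact (key (u - v : ℤ).toNat v u (by rw [Int.toNat_of_nonneg (by omega)]; ring)).symm

/-- **Rmk 2.6.3 (i) (a) in the kernel**: a subgraph `Γ'` of `Γ_Ÿ` (induced on its vertex set) is connected
iff `Γ'` is a nonempty order-convex set of integers. [cite: Mochizuki2012, Rmk 2.6.3 (i) p.79] -/
theorem connected_iff_ordConnected_and_nonempty (Γ : Set ℤ) :
    ((SimpleGraph.hasse ℤ).induce Γ).Connected ↔ Γ.OrdConnected ∧ Γ.Nonempty := by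
  rw [SimpleGraph.connected_iff]
  constructor
  · rintro ⟨hpre, ⟨⟨z, hz⟩⟩⟩
    exact ⟨ordConnected_of_preconnected hpre, ⟨z, hz⟩⟩
  · rintro ⟨hΓ, ⟨z, hz⟩⟩
    exact ⟨preconnected_of_ordConnected hΓ, ⟨⟨z, hz⟩⟩⟩

/-- `0 ∈ [-a, b]`: condition (b) holds for the intervals. [cite: Mochizuki2012, Rmk 2.6.3 (i) p.79] -/
theorem zero_mem_interval (a b : ℕ) : (0 : ℤ) ∈ interval a b := by
  simp [interval]

/-- The intervals `[-a, b]` induce connected subgraphs of `Γ_Ÿ`: condition (a) holds for them.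
[cite: Mochizuki2012, Rmk 2.6.3 (i) p.79] -/
theorem connected_interval (a b : ℕ) :
    ((SimpleGraph.hasse ℤ).induce (interval a b : Set ℤ)).Connected := by
  rw [connected_iff_ordConnected_and_nonempty]
  refine ⟨?_, ⟨0, by exact_mod_cast zero_mem_interval a b⟩⟩
  rw [interval, Finset.coe_Icc]
  exact Set.ordConnected_Icc

/-- **Rmk 2.6.3 (i) (a)+(b) ⟹ interval**: a finite vertex set `Γ' ⊆ ℤ` inducing a preconnected subgraph of
`Γ_Ÿ` and containing the vertex `0` is an integer interval `[-a, b]`, `a, b ∈ ℕ` — the standing shape of all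
interval computations of `ThetaSubgraphNorm`. [cite: Mochizuki2012, Rmk 2.6.3 (i) p.79] -/
theorem eq_interval_of_preconnected {Γ : Finset ℤ}
    (hconn : ((SimpleGraph.hasse ℤ).induce (Γ : Set ℤ)).Preconnected) (h0 : (0 : ℤ) ∈ Γ) :
    ∃ a b : ℕ, Γ = interval a b := by
  have hne : Γ.Nonempty := ⟨0, h0⟩
  have hoc := ordConnected_of_preconnected hconn
  set m := Γ.min' hne with hm
  set M := Γ.max' hne with hM
  have hm0 : m ≤ 0 := Γ.min'_le 0 h0
  have hM0 : 0 ≤ M := Γ.le_max' 0 h0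
  refine ⟨(-m).toNat, M.toNat, ?_⟩
  ext z
  simp only [interval, Finset.mem_Icc]
  rw [Int.toNat_of_nonneg (by omega), Int.toNat_of_nonneg hM0, neg_neg]
  constructor
  · intro hz
    exact ⟨Γ.min'_le z hz, Γ.le_max' z hz⟩
  · rintro ⟨h1, h2⟩
    have := hoc.out (Finset.mem_coe.mpr (Γ.min'_mem hne)) (Finset.mem_coe.mpr (Γ.max'_mem hne))
      ⟨h1, h2⟩
    exact Finset.mem_coe.mp this

/-- **Rmk 2.6.3 (i), the shape of admissible subgraphs**: a finite `Γ' ⊆ ℤ` satisfies "(a) this subgraph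
`Γ'` must be connected" and "(b) this subgraph `Γ'` must contain the vertex of `Γ_Ÿ` labeled «0»" iff
`Γ' = [-a, b]` for some `a, b ∈ ℕ`. [cite: Mochizuki2012, Rmk 2.6.3 (i) p.79] -/
theorem preconnected_and_zero_mem_iff (Γ : Finset ℤ) :
    (((SimpleGraph.hasse ℤ).induce (Γ : Set ℤ)).Preconnected ∧ (0 : ℤ) ∈ Γ) ↔
      ∃ a b : ℕ, Γ = interval a b := by
  constructor
  · rintro ⟨hc, h0⟩
    exact eq_interval_of_preconnected hc h0
  · rintro ⟨a, b, rfl⟩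
    exact ⟨(connected_interval a b).preconnected, zero_mem_interval a b⟩

variable {l : ℕ}

/-! ### (ii) (d): complements to the typer's closed form `‖[-a,b]‖ = (n+1)(2n+1)/6`, `n = min (max a b) l⋇` -/

/-- `|Γ'| ≤ l⋇` for EVERY finite `Γ'`: the nonzero labels lie in `{1, …, l⋇}`. Hence print's "constant for
`|Γ'| ≥ l⋇`" ((d), p. 80) concerns the single case `|Γ'| = l⋇`. [cite: Mochizuki2012, Rmk 2.6.3 (ii) p.80] -/
theorem labelCount_le_half [NeZero l] (Γ : Finset ℤ) : labelCount l Γ ≤ l / 2 := by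
  unfold labelCount
  calc ((Γ.image (absLabel l)).erase 0).card ≤ (Finset.Icc 1 (l / 2)).card := by
        apply Finset.card_le_card
        intro j hj
        simp only [Finset.mem_erase, Finset.mem_image] at hj
        obtain ⟨hj0, z, -, rfl⟩ := hj
        simp only [Finset.mem_Icc]
        exact ⟨Nat.pos_of_ne_zero hj0, absLabel_le_half z⟩
    _ = l / 2 := by simp

/-- **(d), "valued in the positive rational numbers"**: `‖[-a, b]‖ > 0` as soon as `|Γ'| ≥ 1`.
[cite: Mochizuki2012, Rmk 2.6.3 (ii) p.80] -/
theorem subgraphNorm_interval_pos [NeZero l] (a b : ℕ) (hn : 1 ≤ min (max a b) (l / 2)) :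
    0 < subgraphNorm l (interval a b) := by
  rw [subgraphNorm_interval a b hn]
  have h0 : (0 : ℚ) ≤ ((min (max a b) (l / 2) : ℕ) : ℚ) := Nat.cast_nonneg _
  apply div_pos (mul_pos (by linarith) (by linarith)) (by norm_num)

/-- `|Γ^▶_Ÿ| = l⋇` for `Γ^▶_Ÿ = [-l⋇, l⋇]` (Rmk 2.1.1 (ii): the `ι`-stable segment with all `l` vertices).
[cite: Mochizuki2012, Rmk 2.6.3 (ii) p.80] -/
theorem labelCount_gammaArrow [NeZero l] : labelCount l (interval (l / 2) (l / 2)) = l / 2 := by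
  rw [labelCount_interval]; simp

/-- **(d), "attains its maximum when `|Γ'| = l⋇` — hence, in particular, when `Γ'` is taken to be `Γ^▶_Ÿ`"**:
`‖[-a, b]‖ ≤ ‖Γ^▶_Ÿ‖` for every admissible `Γ'` (unconditionally; for `|Γ'| = 0` the left side is the junk
value `0`). [cite: Mochizuki2012, Rmk 2.6.3 (ii) p.80] -/
theorem subgraphNorm_interval_le_gammaArrow [NeZero l] (a b : ℕ) :
    subgraphNorm l (interval a b) ≤ subgraphNorm l (interval (l / 2) (l / 2)) := by
  by_cases hn : 1 ≤ min (max a b) (l / 2)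
  · have hl : 1 ≤ min (max (l / 2) (l / 2)) (l / 2) := by
      simp only [max_self, min_self]; exact hn.trans (min_le_right _ _)
    rw [subgraphNorm_interval a b hn, subgraphNorm_interval (l / 2) (l / 2) hl]
    apply normValue_mono
    simp only [max_self, min_self]
    exact min_le_right _ _
  · have h0 : labelCount l (interval a b) = 0 := by rw [labelCount_interval]; omega
    have hL : subgraphNorm l (interval a b) = 0 := by
      unfold subgraphNorm; rw [h0]; simp
    rw [hL]
    unfold subgraphNorm
    apply div_nonneg
    · exact Finset.sum_nonneg fun j _ => by positivity
    · positivity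

/-- **(d), strict increase below `l⋇`**: the value `(n+1)(2n+1)/6` is STRICTLY increasing in `n = |Γ'|`;
print's "[but not strictly increasing!]" is the saturation `|Γ'| ≤ l⋇` (`labelCount_le_half`,
`subgraphNorm_max`). [cite: Mochizuki2012, Rmk 2.6.3 (ii) p.80] -/
theorem normValue_strictMono {m n : ℕ} (h : m < n) :
    ((m : ℚ) + 1) * (2 * (m : ℚ) + 1) / 6 < ((n : ℚ) + 1) * (2 * (n : ℚ) + 1) / 6 := by
  have : (m : ℚ) + 1 ≤ n := by exact_mod_cast h
  have hm : (0 : ℚ) ≤ m := by positivity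
  nlinarith

/-- **(d) for an arbitrary admissible `Γ'`** (connected, `0 ∈ Γ'`, `|Γ'| ≥ 1`): `‖Γ'‖ = (n+1)(2n+1)/6` with
`n = |Γ'|` — the typer's interval formula transported along (i). [cite: Mochizuki2012, Rmk 2.6.3 (ii) p.80] -/
theorem subgraphNorm_eq_of_preconnected [NeZero l] {Γ : Finset ℤ}
    (hconn : ((SimpleGraph.hasse ℤ).induce (Γ : Set ℤ)).Preconnected) (h0 : (0 : ℤ) ∈ Γ)
    (hn : 1 ≤ labelCount l Γ) :
    subgraphNorm l Γ =
      (((labelCount l Γ : ℕ) : ℚ) + 1) * (2 * ((labelCount l Γ : ℕ) : ℚ) + 1) / 6 := by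
  obtain ⟨a, b, rfl⟩ := eq_interval_of_preconnected hconn h0
  rw [labelCount_interval] at hn ⊢
  exact subgraphNorm_interval a b hn

/-! ### (iii): infinite `Γ'` -/

/-- An infinite order-convex `Γ' ∋ 0` contains a half-line through `0`.
[cite: Mochizuki2012, Rmk 2.6.3 (iii) p.80] -/
theorem Ici_subset_or_Iic_subset_of_infinite {Γ : Set ℤ} (hΓ : Γ.OrdConnected) (h0 : (0 : ℤ) ∈ Γ)
    (hinf : Γ.Infinite) : Set.Ici (0 : ℤ) ⊆ Γ ∨ Set.Iic (0 : ℤ) ⊆ Γ := by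
  by_contra h
  push Not at h
  obtain ⟨h1, h2⟩ := h
  rw [Set.not_subset] at h1 h2
  obtain ⟨N, hN0, hN⟩ := h1
  obtain ⟨M, hM0, hM⟩ := h2
  simp only [Set.mem_Ici, Set.mem_Iic] at hN0 hM0
  apply hinf
  refine (Set.finite_Ioo M N).subset fun z hz => ?_
  simp only [Set.mem_Ioo]
  constructor
  · by_contra hzM
    push Not at hzM
    exact hM (hΓ.out hz h0 ⟨hzM, hM0⟩)
  · by_contra hzN
    push Not at hzN
    exact hN (hΓ.out h0 hz ⟨hN0, hzN⟩)

/-- **Rmk 2.6.3 (iii), the fiber minima exist for infinite `Γ'`**: for an infinite connected `Γ' ∋ 0` and a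
nonzero label `j ≤ l⋇`, the set of squares `j̲²` over the fiber of `Γ'` above `j` has least element `j²`
("`‖Γ'‖` is defined, finite … even for infinite `Γ'`"). [cite: Mochizuki2012, Rmk 2.6.3 (iii) p.80] -/
theorem isLeast_fiber_sq_of_infinite [NeZero l] {Γ : Set ℤ} (hΓ : Γ.OrdConnected) (h0 : (0 : ℤ) ∈ Γ)
    (hinf : Γ.Infinite) {j : ℕ} (hj : j ≤ l / 2) :
    IsLeast ((fun z : ℤ => z.natAbs ^ 2) '' {z | z ∈ Γ ∧ absLabel l z = j}) (j ^ 2) := by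
  constructor
  · rcases Ici_subset_or_Iic_subset_of_infinite hΓ h0 hinf with h | h
    · refine ⟨(j : ℤ), ⟨h (by simp), absLabel_natCast hj⟩, by simp⟩
    · refine ⟨-(j : ℤ), ⟨h (by simp), by rw [absLabel_neg]; exact absLabel_natCast hj⟩, by simp⟩
  · rintro _ ⟨z, ⟨-, hz⟩, rfl⟩
    have := absLabel_le_natAbs (l := l) z
    rw [hz] at this
    exact Nat.pow_le_pow_left this 2

/-- **Rmk 2.6.3 (iii), all labels are attained by an infinite `Γ'`**: `|Γ'| = l⋇`, the saturated value.
[cite: Mochizuki2012, Rmk 2.6.3 (iii) p.80] -/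
theorem labels_of_infinite [NeZero l] {Γ : Set ℤ} (hΓ : Γ.OrdConnected) (h0 : (0 : ℤ) ∈ Γ)
    (hinf : Γ.Infinite) : (absLabel l '' Γ) \ {0} = Set.Icc 1 (l / 2) := by
  ext j
  simp only [Set.mem_sdiff, Set.mem_image, Set.mem_singleton_iff, Set.mem_Icc]
  constructor
  · rintro ⟨⟨z, -, rfl⟩, hj0⟩
    exact ⟨Nat.pos_of_ne_zero hj0, absLabel_le_half z⟩
  · rintro ⟨hj1, hj2⟩
    refine ⟨?_, by omega⟩
    rcases Ici_subset_or_Iic_subset_of_infinite hΓ h0 hinf with h | h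
    · exact ⟨(j : ℤ), h (by simp), absLabel_natCast hj2⟩
    · exact ⟨-(j : ℤ), h (by simp), by rw [absLabel_neg]; exact absLabel_natCast hj2⟩

/-- **Rmk 2.6.3 (iii), "the evident analogue of (d)"**: with fiber minima `j²` over all of `{1, …, l⋇}` and
`|Γ'| = l⋇` (the two facts above), the quantity `‖Γ'‖` of an infinite `Γ'` is the displayed number
`(Σ_{j=1}^{l⋇} j²)/l⋇`, which is exactly `‖Γ^▶_Ÿ‖`, the maximum — "the case of infinite `Γ'` may be excluded
without loss of generality". [cite: Mochizuki2012, Rmk 2.6.3 (iii) p.80] -/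
theorem norm_of_infinite_eq_gammaArrow [NeZero l] :
    (∑ j ∈ Finset.Icc 1 (l / 2), ((j : ℚ) ^ 2)) / ((l / 2 : ℕ) : ℚ) =
      subgraphNorm l (interval (l / 2) (l / 2)) := by
  unfold subgraphNorm
  rw [sum_fiberMinSq_interval, labelCount_interval]
  simp

/-- **Rmk 2.6.3 (iii), "the evident analogue of (d)" on truncations**: for an infinite connected `Γ' ∋ 0`,
EVERY finite truncation `Γ' ∩ [-N, N]` with `N ≥ l⋇` is an admissible subgraph with the saturated count
`|·| = l⋇` and the maximal value `‖·‖ = ‖Γ^▶_Ÿ‖` — the typer's `subgraphNorm` evaluated on the pieces of an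
infinite `Γ'` is the constant maximum, so "the case of infinite `Γ'` may be excluded without loss of
generality" (v2 addendum; `l⋇ ≥ 1`). [cite: Mochizuki2012, Rmk 2.6.3 (iii) p.80] -/
theorem truncation_of_infinite [NeZero l] {Γ : Set ℤ} [DecidablePred (· ∈ Γ)] (hΓ : Γ.OrdConnected)
    (h0 : (0 : ℤ) ∈ Γ) (hinf : Γ.Infinite) (hl : 1 ≤ l / 2) {N : ℕ} (hN : l / 2 ≤ N) :
    labelCount l ((interval N N).filter (· ∈ Γ)) = l / 2 ∧
      subgraphNorm l ((interval N N).filter (· ∈ Γ)) = subgraphNorm l (interval (l / 2) (l / 2)) := by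
  set T := (interval N N).filter (· ∈ Γ) with hT
  have hT0 : (0 : ℤ) ∈ T := Finset.mem_filter.mpr ⟨zero_mem_interval N N, h0⟩
  have hToc : (T : Set ℤ).OrdConnected := by
    have hcoe : (T : Set ℤ) = Set.Icc (-(N : ℤ)) N ∩ Γ := by
      ext z
      simp only [hT, interval, Finset.coe_filter, Finset.mem_Icc, Set.mem_setOf_eq, Set.mem_inter_iff,
        Set.mem_Icc]
    rw [hcoe]
    exact Set.ordConnected_Icc.inter hΓ
  obtain ⟨a, b, hab⟩ := eq_interval_of_preconnected (preconnected_of_ordConnected hToc) hT0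
  have hmax : l / 2 ≤ max a b := by
    rcases Ici_subset_or_Iic_subset_of_infinite hΓ h0 hinf with h | h
    · have hN' : (N : ℤ) ∈ T :=
        Finset.mem_filter.mpr ⟨by simp [interval], h (by simp)⟩
      rw [hab] at hN'
      simp only [interval, Finset.mem_Icc] at hN'
      omega
    · have hN' : -(N : ℤ) ∈ T :=
        Finset.mem_filter.mpr ⟨by simp [interval], h (by simp)⟩
      rw [hab] at hN'
      simp only [interval, Finset.mem_Icc] at hN'
      omega
  rw [hab]
  obtain ⟨h1, h2⟩ := subgraphNorm_max a b hl hmax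
  refine ⟨h1, ?_⟩
  rw [h2, (subgraphNorm_max (l / 2) (l / 2) hl (by simp)).2]

end SubgraphNorm

end Literature.IUT.HodgeArakelov
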